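import Mathlib.Analysis.SpecialFunctions.Complex.Circle
import Mathlib.Data.ZMod.Basic
import Mathlib.Algebra.BigOperators.Fin

/-!
# Chen 2024 (withdrawn), *Quantum Algorithms for Lattice Problems*, Steps 7–9: the objects and the CLAIMS, typed

REPRODUCTION / TYPED SKELETON OF A CLAIMED RESULT UNDER ADJUDICATION — header required by the tree's
literature rule.  Author: Yilei Chen.  Title: *Quantum Algorithms for Lattice Problems*.  Venue: IACR
Cryptology ePrint Archive, Paper 2024/555, version of 18 April 2024. [ChenQuantumLattice2024]
Status of the source: the main claim (a polynomial-time quantum algorithm for `LWE` with polynomial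
modulus-noise ratio, hence for `GapSVP`/`SIVP` within polynomial factors via Regev's reduction) was
WITHDRAWN by the author on 2024-04-18: title page, *"Step 9 of the algorithm contains a bug, which I
don't know how to fix. … Now the claim of showing a polynomial time quantum algorithm for solving LWE
with polynomial modulus-noise ratios does not hold."*; p. 37, *"Here is the bug: the amplitude of
`|φ8.f⟩` does not satisfy `M/2`-periodicity. … So the expression of `|φ8.g⟩` is wrong."*  Page numbers are
the PRINTED page numbers of that version (printed p. N = PDF page N+2).

WHAT IS REPRODUCED HERE (statements only — this file proves nothing and asserts no truth value): the
register model of §2 (Def. 2.16 periodicity, the register operation behind the domain-extension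
Lemma 2.17, `QFT` Lemma 2.12, phase kickback Lemma 2.13), the parameter shape of Steps 8–9 (Cond. C.3
p. 18, eq. (12) p. 17, eq. (39) p. 36), the states `|φ7⟩ = |φ8⟩` (eq. (35) p. 31), `|φ8.b⟩` (p. 35), `|φ8.f⟩`
(eq. (40) p. 36), the DISPLAYED `|φ8.g⟩` (p. 37), and the claims Claim 3.14 (p. 33), the withdrawn
display "`|φ8.g⟩` = domain extension of `|φ8.f⟩`" (p. 37) and Lemma 3.8 / eq. (41) "always" (p. 38) as
`Prop`s.  What is DECIDED about them lives in the sibling files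
`ChenQuantumLWEProductState.lean` / `ChenQuantumLWEProductProofs.lean` (the product-state diagnosis of
eq. (40), proved for every admissible shape).

HONEST FRAMING (bundle `papers/QuantumAdvantage/lwe-quantum-autopsy/`, Part 1): the value of these files
is a precise NEGATIVE result / certificate about a withdrawn algorithm — NOT summit progress, no
cryptanalytic claim in either direction; quantum lower bounds are out of scope.  Nothing here asserts a
defect in, or the correctness of, Steps 1–8 (their proofs, §3.6 pp. 39–60, were not re-verified).

Register model.  A state of `n` registers modulo `m` is a function `(Fin n → ZMod m) → ℂ`
(unnormalised).  `e q = exp(2πi q)` for `q : ℚ`.  Chen's moduli in Steps 8–9 (Cond. C.3, p. 18):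
`M = 2·D²·p₁·p₂⋯p_κ`; we write `Q := p₂⋯p_κ`, `P := p₁·Q = M/(2D²)`, `N := D²·P = M/2`.

Design choices.  The register operation `domainExt` of Lemma 2.17 is defined for EVERY input state (it
adjoins uniform high digits); the lemma's periodicity hypothesis only licenses re-reading its output
through a parametrisation (`DomainExtReadsThrough`) — this separation is what makes the withdrawn
display `Step9Display` a well-typed (false) equation rather than an ill-formed one.  Integer division
`v' 0 / D` in `claim314Pred` is exact under `Admissible.v'_in_DZ`.
-/

namespace Literature.Computability.Cryptography.Chen2024

open scoped BigOperators

/-- `e q := exp(2π i q)`.  Every amplitude occurring in Steps 7–9 is of this form with `q ∈ ℚ`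
(notation of §2, p. 11). [cite: ChenQuantumLattice2024, §2 p. 11] -/
noncomputable def e (q : ℚ) : ℂ := Complex.exp (2 * Real.pi * Complex.I * (q : ℂ))

/-- An (unnormalised) state of `n` registers `ℤ_m` (the computational-basis amplitude function).
[cite: ChenQuantumLattice2024, §2.2 p. 12] -/
abbrev Ket (n m : ℕ) : Type := (Fin n → ZMod m) → ℂ

/-- Def. 2.16 (p. 14): `f : ℤⁿ → ℂ` is `P`-periodic. [cite: ChenQuantumLattice2024, Def. 2.16 p. 14] -/
def IsPeriodic {n : ℕ} (P : ℕ) (f : (Fin n → ℤ) → ℂ) : Prop :=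
  ∀ x y : Fin n → ℤ, (∀ i, ((x i : ℤ) : ZMod P) = ((y i : ℤ) : ZMod P)) → f x = f y

/-- The state `Σ_{x ∈ ℤ_Pⁿ} f(x)|x⟩` denoted by a `P`-periodic `f : ℤⁿ → ℂ` (the input of Lemma 2.17):
amplitude of the basis vector `x` = `f` of the canonical lift of `x`.
[cite: ChenQuantumLattice2024, Lemma 2.17 p. 14] -/
def ketOf {n : ℕ} (P : ℕ) (f : (Fin n → ℤ) → ℂ) : Ket n P :=
  fun x => f (fun i => ((x i).val : ℤ))

/-- The register operation implementing Lemma 2.17 (p. 14) on ALL coordinates: adjoin uniform high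
digits, `|x⟩ ↦ Σ_{h ∈ ℤ_Cⁿ} |x + P·h⟩`.  On amplitudes: the new amplitude at `z ∈ ℤ_{CP}ⁿ` is the old
amplitude at `z mod P`.  Defined for EVERY input state; when the input is `ketOf P f` with `f`
`P`-periodic the output is `ketOf (C*P) f` (`DomainExtReadsThrough`), which is how the paper USES it.
[cite: ChenQuantumLattice2024, Lemma 2.17 p. 14] -/
def domainExt {n P : ℕ} (C : ℕ) (ψ : Ket n P) : Ket n (C * P) :=
  fun z => ψ (fun i => ZMod.castHom (dvd_mul_left P C) (ZMod P) (z i))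

/-- Lemma 2.17, second form: extension of the FIRST coordinate only (used in Step 9, p. 37).
[cite: ChenQuantumLattice2024, Lemma 2.17 p. 14 and §3.5.9 p. 37] -/
def domainExtFirst {n P : ℕ} (C : ℕ) (ψ : Ket (n + 1) P) : ZMod (C * P) × (Fin n → ZMod P) → ℂ :=
  fun z => ψ (Fin.cons (ZMod.castHom (dvd_mul_left P C) (ZMod P) z.1) z.2)

/-- The content of Lemma 2.17 as used in the paper (a statement; not needed below): for `P`-periodic
`f`, `domainExt C (ketOf P f) = ketOf (C*P) f`. [cite: ChenQuantumLattice2024, Lemma 2.17 p. 14] -/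
def DomainExtReadsThrough {n : ℕ} (P C : ℕ) (f : (Fin n → ℤ) → ℂ) : Prop :=
  IsPeriodic P f → domainExt C (ketOf P f) = ketOf (C * P) f

/-- `QFT_{ℤ_mⁿ}` (Lemma 2.12, p. 12), unnormalised, Chen's sign convention `e^{-2πi⟨z,u⟩/m}`.
[cite: ChenQuantumLattice2024, Lemma 2.12 p. 12] -/
noncomputable def qft {n m : ℕ} [NeZero m] (ψ : Ket n m) : Ket n m :=
  fun u => ∑ z : Fin n → ZMod m, ψ z * e (-(((∑ i, (z i).val * (u i).val : ℕ) : ℚ) / m))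

/-- Phase kickback (Lemma 2.13, p. 13) by an efficiently computable phase `g` (in turns).
[cite: ChenQuantumLattice2024, Lemma 2.13 p. 13] -/
noncomputable def kick {n m : ℕ} (g : (Fin n → ZMod m) → ℚ) (ψ : Ket n m) : Ket n m :=
  fun z => ψ z * e (g z)

/-- Born weight of outcome `u` (unnormalised). [folklore] -/
noncomputable def weight {n m : ℕ} (ψ : Ket n m) (u : Fin n → ZMod m) : ℝ := ‖ψ u‖ ^ 2

/-! ### The shape of Steps 8–9 (Cond. C.3 and eq. (12), (39)) -/

/-- Parameters and vectors entering Steps 8–9.  `b` is the short vector of eq. (12) (`b 0 = -1`,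
`2p₁ ∣ b i` for `i ≠ 0`); `v'` the unknown offset of eq. (35) (`v' ∈ Dℤⁿ`); `bstar`, `vstar` the vectors
of eq. (39) AFTER the CRT-slot swap (derived data, recorded with the properties Chen derives:
`bstar 0 = Q`, `p₁ ∣ bstar i` (`i ≠ 0`), `vstar 0 = 0` after the subtraction of the known `v*₁`).
Coordinates are indexed `0..n` here (the paper's `1..n+1`).
[cite: ChenQuantumLattice2024, Cond. C.3 p. 18, eq. (12) p. 17, eq. (39) p. 36] -/
structure Shape where
  /-- number of coordinates minus one (`n` unknown-carrying coordinates follow coordinate `0`) -/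
  n : ℕ
  /-- the scaling factor `D` of Cond. C.3 (odd) -/
  D : ℕ+
  /-- the first planted prime `p₁` -/
  p₁ : ℕ+
  /-- `Q = p₂⋯p_κ` -/
  Q : ℕ+
  /-- the short vector `b` of eq. (12) -/
  b : Fin (n + 1) → ℤ
  /-- the unknown offset `v'` of eq. (35) -/
  v' : Fin (n + 1) → ℤ
  /-- `b*` of eq. (39) (after the CRT-slot swap) -/
  bstar : Fin (n + 1) → ℤ
  /-- `v*` of eq. (39)/(40) (after the swap and the subtraction of the known first offset) -/
  vstar : Fin (n + 1) → ℤ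

namespace Shape

variable (S : Shape)

/-- `P = p₁Q = M/(2D²)` — the period of `j` and the modulus of eq. (41).
[cite: ChenQuantumLattice2024, Cond. C.3 p. 18] -/
def P : ℕ+ := S.p₁ * S.Q
/-- `N = D²P = M/2` — the register modulus in Step 9. [cite: ChenQuantumLattice2024, Cond. C.3 p. 18] -/
def N : ℕ+ := S.D * S.D * S.P
/-- `M = 2N` — the register modulus of `|φ7⟩` (eq. (35)). [cite: ChenQuantumLattice2024, Cond. C.3 p. 18] -/
def M : ℕ+ := 2 * S.N

/-- Chen's admissibility (C.3 p. 18, eq. (12) p. 17, eq. (39) p. 36).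
[cite: ChenQuantumLattice2024, Cond. C.3 p. 18, eq. (12) p. 17, eq. (39) p. 36] -/
structure Admissible : Prop where
  odd_D : Odd (S.D : ℕ)
  odd_p₁ : Odd (S.p₁ : ℕ)
  odd_Q : Odd (S.Q : ℕ)
  cop_Dp : Nat.Coprime S.D S.p₁
  cop_DQ : Nat.Coprime S.D S.Q
  cop_pQ : Nat.Coprime S.p₁ S.Q
  three_le_p₁ : 3 ≤ (S.p₁ : ℕ)
  three_le_Q : 3 ≤ (S.Q : ℕ)
  /-- C.3: `p₂⋯p_κ ≡ -1 (mod p₁)` -/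
  Q_mod : ((S.Q : ℕ) : ZMod S.p₁) = -1
  b_head : S.b 0 = -1
  b_tail : ∀ i, i ≠ 0 → (2 * (S.p₁ : ℤ)) ∣ S.b i
  v'_in_DZ : ∀ i, (S.D : ℤ) ∣ S.v' i
  bstar_head : S.bstar 0 = S.Q
  bstar_tail : ∀ i, i ≠ 0 → (S.p₁ : ℤ) ∣ S.bstar i
  vstar_head : S.vstar 0 = 0

/-! ### Step 7 output = Step 8 input, eq. (35) p. 31 -/

/-- `k ∈ 0|{0,1}ⁿ` as an integer vector with first coordinate `0`.
[cite: ChenQuantumLattice2024, eq. (35) p. 31] -/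
def kLift (k : Fin S.n → Fin 2) : Fin (S.n + 1) → ℤ :=
  Fin.cons (0 : ℤ) (fun t => ((k t : ℕ) : ℤ))

/-- The basis vector `2Dj·x + v' + (M/2)k mod M` of eq. (35), `x = D·b`, `k ∈ 0|{0,1}ⁿ`.
[cite: ChenQuantumLattice2024, eq. (35) p. 31] -/
def pt7 (j : ℕ) (k : Fin S.n → Fin 2) : Fin (S.n + 1) → ZMod S.M :=
  fun i => ((2 * (S.D : ℤ) * j * ((S.D : ℤ) * S.b i) + S.v' i + (S.N : ℤ) * S.kLift k i : ℤ) : ZMod S.M)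

/-- `|φ7⟩ = |φ8⟩` (eq. (35)): `Σ_{k ∈ 0|ℤ^{n}, j ∈ ℤ} e(-(2Dj)²/(2M)) e(‖k‖²/4) |2Djx + v' + (M/2)k mod M⟩`,
one period of `j` (`j ∈ [0,P)`, since `(2Dj)²/(2M) = j²/P`) and `k ∈ {0,1}ⁿ` (only `k mod 2` matters,
with these phases). [cite: ChenQuantumLattice2024, eq. (35) p. 31] -/
noncomputable def phi7 : Ket (S.n + 1) S.M :=
  fun z => ∑ j ∈ Finset.range S.P, ∑ k : Fin S.n → Fin 2,
    if z = S.pt7 j k then e (-((j : ℚ) ^ 2) / S.P) * e ((∑ t, ((k t : ℕ) : ℚ) ^ 2) / 4) else 0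

/-- The amplitude function `f₇ : ℤⁿ⁺¹ → ℂ` of eq. (37) p. 32, whose `M`-periodicity (eq. (38); author's
note p. 32: "correct") licenses Step 8's domain extension `ℤ_M → ℤ_{DM}`.
[cite: ChenQuantumLattice2024, eq. (37)–(38) p. 32] -/
noncomputable def f7 : (Fin (S.n + 1) → ℤ) → ℂ :=
  fun a => ∑ j ∈ Finset.range S.P, ∑ k : Fin S.n → Fin 2,
    if (fun i => ((a i : ℤ) : ZMod S.M)) = S.pt7 j k
    then e (-((j : ℚ) ^ 2) / S.P) * e ((∑ t, ((k t : ℕ) : ℚ) ^ 2) / 4) else 0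

/-- Statement of the author's p. 32 verification: `f₇` is `M`-periodic (true by construction here,
since `f₇` is defined through residues mod `M`; recorded to contrast with `Step9Display`).
[cite: ChenQuantumLattice2024, eq. (38) p. 32] -/
def Step8Premise : Prop := IsPeriodic (S.M : ℕ) S.f7

/-! ### Step 8 (Lemma 3.13, Claim 3.14, pp. 32–34) -/

/-- The measured predicate of Claim 3.14 (p. 33) on an outcome `w ∈ ℤ_Mⁿ⁺¹`: the three congruences
`⟨b, w⟩ + v'₀/D ≡ 0 (mod M/(2D))`, `D ∣ w_i (i ≠ 0)`, `w₀ ≡ v'₀/D (mod D p₁)`.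
[cite: ChenQuantumLattice2024, Claim 3.14 p. 33] -/
def claim314Pred (w : Fin (S.n + 1) → ZMod S.M) : Prop :=
  (((∑ i, S.b i * ((w i).val : ℤ) + S.v' 0 / S.D : ℤ) : ZMod ((S.M : ℕ) / (2 * S.D))) = 0)
  ∧ (∀ i, i ≠ 0 → (S.D : ℕ) ∣ (w i).val)
  ∧ (((w 0).val : ℤ) : ZMod ((S.D : ℕ) * S.p₁)) = ((S.v' 0 / S.D : ℤ) : ZMod ((S.D : ℕ) * S.p₁))

/-- Claim 3.14 (p. 33) as a statement about a state `ψ = |φ7.d⟩` on `ℤ_Mⁿ⁺¹`: every outcome with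
non-zero amplitude satisfies the three congruences; consequently Step 8 outputs `v'₀ mod D²p₁` with
certainty.  A CLAIM of the source (proof §3.6), not asserted here.
[cite: ChenQuantumLattice2024, Claim 3.14 p. 33] -/
def Claim314 (ψ : Ket (S.n + 1) S.M) : Prop := ∀ w, ψ w ≠ 0 → S.claim314Pred w

/-- What Step 8 delivers (Lemma 3.13): the residue `v'₀ mod D²p₁` — as the function of the unknown it
reveals. [cite: ChenQuantumLattice2024, Lemma 3.13 p. 32] -/
def step8Output : ZMod ((S.D : ℕ) ^ 2 * S.p₁) := ((S.v' 0 : ℤ) : ZMod ((S.D : ℕ) ^ 2 * S.p₁))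

/-- What Step 9 needs (this bundle's diagnosis, `STEPS.md` §4.3): the residue `v'₀ mod N = v'₀ mod M/2`
(cf. p. 22, "learn one coordinate of `v′`"). [cite: ChenQuantumLattice2024, §3.5 p. 22 and §3.5.9 p. 37] -/
def step9Needs : ZMod S.N := ((S.v' 0 : ℤ) : ZMod S.N)

/-! ### Step 9 (§3.5.9, pp. 34–38) -/

/-- Basis vector of `|φ8.b⟩` (p. 35): `2D²j·b + v' mod N`. [cite: ChenQuantumLattice2024, §3.5.9 p. 35] -/
def pt8b (j : ℕ) : Fin (S.n + 1) → ZMod S.N :=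
  fun i => ((2 * (S.D : ℤ) ^ 2 * j * S.b i + S.v' i : ℤ) : ZMod S.N)

/-- `|φ8.b⟩ = Σ_{j ∈ ℤ_P} e(-j²/P) |2D²jb + v' mod N⟩` (after measuring the mod-2 part, p. 35).
[cite: ChenQuantumLattice2024, §3.5.9 p. 35] -/
noncomputable def phi8b : Ket (S.n + 1) S.N :=
  fun z => ∑ j ∈ Finset.range S.P, if z = S.pt8b j then e (-((j : ℚ) ^ 2) / S.P) else 0

/-- Basis vector of `|φ8.f⟩` (eq. (40) p. 36): `2D²j·b* + (0 | v*[1..n]) mod N`.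
[cite: ChenQuantumLattice2024, eq. (40) p. 36] -/
def pt8f (j : ℕ) : Fin (S.n + 1) → ZMod S.N :=
  fun i => ((2 * (S.D : ℤ) ^ 2 * j * S.bstar i + S.vstar i : ℤ) : ZMod S.N)

/-- `|φ8.f⟩ = Σ_{j ∈ ℤ_P} e(-j²/P) |2D²jb* + 0|v* mod N⟩` (eq. (40)).
[cite: ChenQuantumLattice2024, eq. (40) p. 36] -/
noncomputable def phi8f : Ket (S.n + 1) S.N :=
  fun z => ∑ j ∈ Finset.range S.P, if z = S.pt8f j then e (-((j : ℚ) ^ 2) / S.P) else 0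

/-- The DISPLAYED `|φ8.g⟩` (p. 37): first coordinate `2D²j·b*₀ mod N·Q` driven by the SAME `j` as the
rest. [cite: ChenQuantumLattice2024, §3.5.9 p. 37] -/
noncomputable def phi8gDisplayed : ZMod ((S.Q : ℕ) * S.N) × (Fin S.n → ZMod S.N) → ℂ :=
  fun z => ∑ j ∈ Finset.range S.P,
    if z = ((((2 * (S.D : ℤ) ^ 2 * j * S.bstar 0 : ℤ) : ZMod ((S.Q : ℕ) * S.N))),
            fun t => S.pt8f j (Fin.succ t))
    then e (-((j : ℚ) ^ 2) / S.P) else 0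

/-- THE WITHDRAWN EQUATION (p. 37, author's note "the expression of `|φ8.g⟩` is wrong"):
"`domainExtFirst Q |φ8.f⟩ = |φ8.g⟩` as displayed".  A well-typed `Prop`; the bundle's package module
`StepNine` (Part 4) proves the supports differ (`P·Q` versus `P` points) for every admissible parameter
choice, and `ChenQuantumLWEProductProofs` explains why no variant of the subsequent local processing can
help.  Not asserted here. [cite: ChenQuantumLattice2024, §3.5.9 p. 37] -/
def Step9Display : Prop := domainExtFirst (S.Q : ℕ) S.phi8f = S.phi8gDisplayed

/-- Eq. (41) for an outcome `u ∈ ℤ_Nⁿ⁺¹`: `u₀ + ⟨b*[1..n], u[1..n]⟩ ≡ 0 (mod P)`.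
[cite: ChenQuantumLattice2024, eq. (41) p. 38] -/
def eq41 (u : Fin (S.n + 1) → ZMod S.N) : Prop :=
  ((((u 0).val : ℤ) + ∑ t : Fin S.n, S.bstar (Fin.succ t) * ((u (Fin.succ t)).val : ℤ) : ℤ) :
    ZMod S.P) = 0

/-- Lemma 3.8 / eq. (41) "always" (p. 38), as a statement about whatever state `ψ9` Step 9 feeds to the
final QFT: every outcome of non-zero weight satisfies (41).  For the state Chen's operations actually
produce this is FALSE (probability `1/Q`; `STEPS.md` §4.5, `REPAIR-CENSUS.md` T2 of the bundle); typed
here, not asserted. [cite: ChenQuantumLattice2024, Lemma 3.8 and eq. (41) p. 38] -/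
def Lemma38Certainty (ψ9 : Ket (S.n + 1) S.N) : Prop := ∀ u, qft ψ9 u ≠ 0 → S.eq41 u

end Shape

end Literature.Computability.Cryptography.Chen2024
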